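import Summits.NavierStokesRegularity.FluidComputer.PalasekTowerGermHostAt
import Summits.NavierStokesRegularity.FluidComputer.PalasekTowerRegisterGlobalExactSlice

/-!
# The germ host at arbitrary rates — THE SLICE-RUN DOOR AT `R`: `EpisodeBaseGAt R` from ANY strict-slot
# filler at `R` and ONE run of the first window starting from its profile (layer L4a of the door port)

Cell `ns-blowup`, seat `ns-blowup-ecbridge-3` (g8); GROUP C «BRIDGE SUPPORT» of the route
`PalasekTowerBreakdown` after the RE-BASE (rev 19; live crux `EpisodeBaseT := EpisodeBaseGAt TowerRates.tuned`,
stmt-NavierStokesRegularity-20303). Composition of `PalasekTowerGermHostAt.lean` (g8: host preparation at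
every admissible register — the level-`0` stage of the germ schedule of a profile `U` in the strict slot
`Germ.LevelZeroDataAt R U ρ`) with ecbridge-4's REGISTER-GENERIC exact-slice heredity
`Stage.exists_extends_of_sliceRun` (`PalasekTowerRegisterGlobalExactSlice.lean`, any rates, any `ν > 0`) and the
W14-free stage uniqueness `Stage.velocity_eq_of_classical`. LABEL: E–C typing (KERNEL: theorems only). WHAT
THIS IS NOT: not Navier–Stokes evidence — no run of the first window is exhibited; `EpisodeBaseGAt R` appears
only as the conclusion of a conditional; nothing about `RungG 1` or blow-up.

* `LevelZeroDataAt.stage_slice` — the level-`0` stage of the germ schedule at `R` has slice `u(τ₀) = U` (any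
  stage of that schedule does: uniqueness against the germ);
* **`LevelZeroDataAt.episodeBaseGAt_of_sliceRun`** — `h : LevelZeroDataAt R U ρ`, `hR : R.BoxNumerics c₃ r`,
  `c₄ ∈ (0, 1]`, and ONE classical finite-energy solution `(v, q)` on the first window `[1, τ₁(R)]` of
  Navier–Stokes at unit viscosity FORCED BY THE GERM SCHEDULE'S (fading, `≤ c₄Y₀(R)`, zero from `1 + ε` on)
  FORCE, starting from the profile `v 1 = U`, below `(5/3) Y₁(R)`, showing at `τ₁(R)` in `B̄(0, ρ)` speed
  `≥ Y₁(R)`, gradient `≥ A₁(R)`, an `N₁(R)`-core loop of circulation `≥ N₁(R)^{β−2}` ⟹ `EpisodeBaseGAt R`;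
* `LevelZeroDataAt.episodeBaseGAt_tuned_of_sliceRun` — the instance at `TowerRates.tuned` (numerics
  `tuned_boxNumerics`), i.e. the route's `EpisodeBaseT` from one slice run of any tuned slot filler.

The FREE-run and SUPERPOSITION doors at `R` (forced run near the free run; far-apart amplifier) are the next
layer (L4b: `LineGermData`/`lineForce` at `R` with a restrictable fade, on the register-free `PerturbedRun*` /
`SuperposedRun*`).

References: S. Palasek, arXiv:2605.13827 §4 [cite: Palasek2026ElementaryModel, §4]; H. Sohr, *The
Navier–Stokes Equations*, Birkhäuser 2001, Ch. V Thm. 1.5.1 [cite: Sohr2001, Ch. V Thm. 1.5.1].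
-/

noncomputable section

namespace Summit.NavierStokesRegularity.FluidComputer.PalasekTowerClayBridge.Germ

open Set Function Filter Topology Metric MeasureTheory
open scoped Topology ContDiff ENNReal

open Literature.Analysis.FluidPDE

namespace LevelZeroDataAt

variable {R : TowerRates} {U : EuclideanSpace ℝ (Fin 3) → EuclideanSpace ℝ (Fin 3)} {ρ : ℝ}
  (h : LevelZeroDataAt R U ρ)
include h

/-- **Every level-`0` stage of the germ schedule at `R` has slice `u(τ₀) = U`** (W14-free uniqueness of
classical finite-energy solutions against the germ `h.vel`, `Stage.velocity_eq_of_classical`). [cite: Sohr2001, Ch. V Thm. 1.5.1] -/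
theorem stage_slice {c₃ r : ℝ} (hR : R.BoxNumerics c₃ r) {c₄ : ℝ} (hc₄ : 0 < c₄) (hc₄' : c₄ ≤ 1)
    (s₀ : Stage 1 R (h.schedule hR c₄ hc₄ hc₄') (Margins.routeG R) 0) : s₀.u 1 = U := by
  have hτ0 : (h.schedule hR c₄ hc₄ hc₄').τ 0 = 1 := h.schedule_τ_zero hR hc₄ hc₄'
  obtain ⟨hv0, hv1, -, hE⟩ := h.vel_spec
  have h0 : h.vel 0 = (h.schedule hR c₄ hc₄ hc₄').u₀ := by rw [hv0]; rfl
  have key := s₀.velocity_eq_of_classical one_pos (T' := 1) (by rw [hτ0])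
    (h.isClassicalNSSolutionOn_vel hR hc₄ hc₄') h0 hE
  rw [hτ0] at key
  rw [← key 1 ⟨zero_le_one, le_rfl⟩, hv1]

/-- **THE SLICE-RUN DOOR AT THE RATES `R`.** A strict-slot filler `h : LevelZeroDataAt R U ρ` at a
register-admissible `R` (`hR : R.BoxNumerics c₃ r`), a push constant `c₄ ∈ (0, 1]`, and ONE classical solution
`(v, q)` of Navier–Stokes at unit viscosity on the first window `[1, τ₁(R)]` forced by the germ schedule's force
`h.force hc₄` (the faded residual: `≤ c₄ Y₀(R)`, zero from `1 + ε` on), STARTING FROM THE PROFILE `v 1 = U`, with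
finite energy, `‖v‖ ≤ (5/3) Y₁(R)` on the window, and at `τ₁(R)`, in `B̄(0, ρ)`: speed `≥ Y₁(R)`, gradient
`≥ A₁(R)`, an `N₁(R)`-core loop with circulation `≥ N₁(R)^{β−2}` ⟹ `EpisodeBaseGAt R` (the germ host supplies
the level-`0` stage; `Stage.exists_extends_of_sliceRun` glues the window run onto it).
[cite: Palasek2026ElementaryModel, §4] [cite: Sohr2001, Ch. V Thm. 1.5.1] -/
theorem episodeBaseGAt_of_sliceRun {c₃ r : ℝ} (hR : R.BoxNumerics c₃ r) {c₄ : ℝ} (hc₄ : 0 < c₄) (hc₄' : c₄ ≤ 1)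
    {v : ℝ → EuclideanSpace ℝ (Fin 3) → EuclideanSpace ℝ (Fin 3)} {q : ℝ → EuclideanSpace ℝ (Fin 3) → ℝ}
    (hcl : IsClassicalNSSolutionOn (Icc 1 (Host.τfirstAt R)) 1 (h.force hc₄) v q) (h1 : v 1 = U)
    (henergy : ∃ C : ℝ≥0∞, C < ⊤ ∧ ∀ t ∈ Icc (1 : ℝ) (Host.τfirstAt R), ∫⁻ x, ‖v t x‖ₑ ^ 2 ≤ C)
    (hceil : ∀ t ∈ Icc (1 : ℝ) (Host.τfirstAt R), ∀ x, ‖v t x‖ ≤ 5 / 3 * R.Y 1)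
    (hfloor : ∃ x, ‖x‖ ≤ ρ ∧ R.Y 1 ≤ ‖v (Host.τfirstAt R) x‖)
    (hstrain : ∃ x, ‖x‖ ≤ ρ ∧ R.A 1 ≤ ‖fderiv ℝ (v (Host.τfirstAt R)) x‖)
    (hcore : ∃ (x : EuclideanSpace ℝ (Fin 3)) (γ : ℝ → EuclideanSpace ℝ (Fin 3)),
      ‖x‖ ≤ ρ ∧ ContDiff ℝ 1 γ ∧ γ 0 = γ 1 ∧
      (∀ s ∈ Icc (0 : ℝ) 1, γ s ∈ closedBall x (1 / R.N 1)) ∧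
      (∀ s ∈ Icc (0 : ℝ) 1, ‖deriv γ s‖ ≤ 8 * Real.pi / R.N 1) ∧
      R.N 1 ^ (R.β - 2) ≤ circulation (v (Host.τfirstAt R)) γ) :
    EpisodeBaseGAt R := by
  obtain ⟨s₀⟩ := h.stage hR hc₄ hc₄'
  set S := h.schedule hR c₄ hc₄ hc₄' with hS
  have hτ0 : S.τ 0 = 1 := h.schedule_τ_zero hR hc₄ hc₄'
  have hτ1 : S.τ 1 = Host.τfirstAt R := rfl
  have hslice : s₀.u 1 = U := h.stage_slice hR hc₄ hc₄' s₀
  have hext : ∃ s' : Stage 1 R S (Margins.routeG R) (0 + 1), s₀.Extends s' := by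
    refine s₀.exists_extends_of_sliceRun one_pos (v := v) (q := q) ?_ ?_ ?_ ?_ ?_ ?_ ?_
    · show IsClassicalNSSolutionOn (Icc (S.τ 0) (S.τ (0 + 1))) 1 S.f v q
      rw [hτ0, zero_add, hτ1]; exact hcl
    · show v (S.τ 0) = s₀.u (S.τ 0)
      rw [hτ0, h1, hslice]
    · show ∃ C : ℝ≥0∞, C < ⊤ ∧ ∀ t ∈ Icc (S.τ 0) (S.τ (0 + 1)), ∫⁻ x, ‖v t x‖ₑ ^ 2 ≤ C
      rw [hτ0, zero_add, hτ1]; exact henergy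
    · show ∀ t ∈ Icc (S.τ 0) (S.τ (0 + 1)), ∀ x, ‖v t x‖ ≤ S.c₂ * R.Y (0 + 1)
      rw [hτ0, zero_add, hτ1, h.schedule_c₂ hR hc₄ hc₄']; exact hceil
    · show ∃ x, ‖x‖ ≤ S.radius ∧ S.c₁ * R.Y (0 + 1) ≤ ‖v (S.τ (0 + 1)) x‖
      rw [zero_add, hτ1, h.schedule_radius hR hc₄ hc₄', h.schedule_c₁ hR hc₄ hc₄', one_mul]; exact hfloor
    · show ∃ x, ‖x‖ ≤ S.radius ∧ S.c₁ * R.A (0 + 1) ≤ ‖fderiv ℝ (v (S.τ (0 + 1))) x‖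
      rw [zero_add, hτ1, h.schedule_radius hR hc₄ hc₄', h.schedule_c₁ hR hc₄ hc₄', one_mul]; exact hstrain
    · show ∃ (x : EuclideanSpace ℝ (Fin 3)) (γ : ℝ → EuclideanSpace ℝ (Fin 3)),
        ‖x‖ ≤ S.radius ∧ ContDiff ℝ 1 γ ∧ γ 0 = γ 1 ∧
        (∀ σ ∈ Icc (0 : ℝ) 1, γ σ ∈ closedBall x (1 / R.N (0 + 1))) ∧
        (∀ σ ∈ Icc (0 : ℝ) 1, ‖deriv γ σ‖ ≤ 8 * Real.pi / R.N (0 + 1)) ∧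
        S.c₁ * R.N (0 + 1) ^ (R.β - 2) ≤ circulation (v (S.τ (0 + 1))) γ
      rw [zero_add, hτ1, h.schedule_radius hR hc₄ hc₄', h.schedule_c₁ hR hc₄ hc₄', one_mul]; exact hcore
  obtain ⟨s₁, -⟩ := hext
  exact ⟨S, h.schedule_pins hR hc₄ hc₄', h.schedule_rigid hR hc₄ hc₄', h.schedule_quiet hR hc₄ hc₄', ⟨s₁⟩⟩

end LevelZeroDataAt

/-- **THE SLICE-RUN DOOR AT `TowerRates.tuned`**: a strict-slot filler `h : LevelZeroDataAt tuned U ρ`,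
`c₄ ∈ (0, 1]`, and ONE classical finite-energy run of the first tuned window `[1, τ₁(tuned)]` forced by its germ
schedule's fading force (numerics `tuned_boxNumerics`: `c₃ = 128`, `r = 1/3`), from `v 1 = U`, below
`(5/3) Y₁`, with the three level-`1` floors at `τ₁(tuned)` in `B̄(0, ρ)` ⟹ `EpisodeBaseGAt TowerRates.tuned` (the
re-based route's `EpisodeBaseT`). [cite: Palasek2026ElementaryModel, §4] -/
theorem LevelZeroDataAt.episodeBaseGAt_tuned_of_sliceRun
    {U : EuclideanSpace ℝ (Fin 3) → EuclideanSpace ℝ (Fin 3)} {ρ : ℝ} (h : LevelZeroDataAt TowerRates.tuned U ρ)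
    {c₄ : ℝ} (hc₄ : 0 < c₄) (hc₄' : c₄ ≤ 1)
    {v : ℝ → EuclideanSpace ℝ (Fin 3) → EuclideanSpace ℝ (Fin 3)} {q : ℝ → EuclideanSpace ℝ (Fin 3) → ℝ}
    (hcl : IsClassicalNSSolutionOn (Icc 1 (Host.τfirstAt TowerRates.tuned)) 1 (h.force hc₄) v q) (h1 : v 1 = U)
    (henergy : ∃ C : ℝ≥0∞, C < ⊤ ∧ ∀ t ∈ Icc (1 : ℝ) (Host.τfirstAt TowerRates.tuned), ∫⁻ x, ‖v t x‖ₑ ^ 2 ≤ C)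
    (hceil : ∀ t ∈ Icc (1 : ℝ) (Host.τfirstAt TowerRates.tuned), ∀ x, ‖v t x‖ ≤ 5 / 3 * TowerRates.tuned.Y 1)
    (hfloor : ∃ x, ‖x‖ ≤ ρ ∧ TowerRates.tuned.Y 1 ≤ ‖v (Host.τfirstAt TowerRates.tuned) x‖)
    (hstrain : ∃ x, ‖x‖ ≤ ρ ∧ TowerRates.tuned.A 1 ≤ ‖fderiv ℝ (v (Host.τfirstAt TowerRates.tuned)) x‖)
    (hcore : ∃ (x : EuclideanSpace ℝ (Fin 3)) (γ : ℝ → EuclideanSpace ℝ (Fin 3)),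
      ‖x‖ ≤ ρ ∧ ContDiff ℝ 1 γ ∧ γ 0 = γ 1 ∧
      (∀ s ∈ Icc (0 : ℝ) 1, γ s ∈ closedBall x (1 / TowerRates.tuned.N 1)) ∧
      (∀ s ∈ Icc (0 : ℝ) 1, ‖deriv γ s‖ ≤ 8 * Real.pi / TowerRates.tuned.N 1) ∧
      TowerRates.tuned.N 1 ^ (TowerRates.tuned.β - 2) ≤ circulation (v (Host.τfirstAt TowerRates.tuned)) γ) :
    EpisodeBaseGAt TowerRates.tuned :=
  h.episodeBaseGAt_of_sliceRun TowerRates.tuned_boxNumerics hc₄ hc₄' hcl h1 henergy hceil hfloor hstrain hcore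

end Summit.NavierStokesRegularity.FluidComputer.PalasekTowerClayBridge.Germ

end
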